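import Literature.NumberTheory.Transcendental.KZDilationBakerSectorComplexRelations
import Literature.NumberTheory.Transcendental.KZPeriodsProofs
import HarnessLib

/-!
# The Liouville sector of the dilation pencil, I: Baker's theorem on differences of logarithms

Abstract form of the arithmetic input of the one-variable lifting mechanism (route
`KontsevichZagierPeriods/LiftingCriteria`, crux `DilationLiftAtOne`), for LOOPS rather than affine
functions. Let `ζ₀_k, ζ₁_k ∈ ℚ̄ ⊂ ℂ` be non-zero (the endpoint values `w_k(0)`, `w_k(1)` of Nash
loops `w_k`), `c_k = γ_k + iδ_k ∈ ℚ̄`, `r ∈ ℚ̄ ∩ ℝ`, and suppose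
  `r + Σ_k Re(c_k (Log ζ₁_k − Log ζ₀_k)) = 0`.
Then (`liouville_decomposition`) `r = 0`, and there are real algebraic `aR_j, aI_j` and rational
`e_{jk}, f_{jk}` (`j ∈ Fin A ⊕ Fin A`) with the EXACT endpoint relations
  `Σ_k e_{jk} (log‖ζ₁_k‖ − log‖ζ₀_k‖) = 0`,  `Σ_k f_{jk} (arg ζ₁_k − arg ζ₀_k) = 0`
and the universal decomposition, for ALL `Z : Fin A → ℂ`,
  `Σ_k Re(c_k Z_k) = Σ_j (aR_j Σ_k e_{jk} Re Z_k − aI_j Σ_k f_{jk} Im Z_k)`.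
Proof: Baker in decomposition form (`baker_decomposition_complex`) on the family
`(L_k, conj L_k)`, `L_k = Log ζ₁_k − Log ζ₀_k` — ANY determination of the logarithm of the
algebraic number `ζ₁_k/ζ₀_k` is admissible there (`exp L_k = ζ₁_k/ζ₀_k`), which is what makes
differences of principal logarithms usable without branch bookkeeping.

Everything is proved; no `def`, no named fact.

## References
* A. Baker, *Transcendental Number Theory* (1975), Thm. 2.1. [`Baker1975`]
-/

noncomputable section

open Complex
open scoped BigOperators Real ComplexConjugate

namespace Literature.NumberTheory.Transcendental

namespace KZ.LiouvilleSector

open KZ.BakerSectorComplex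

/-- **Baker's theorem on differences of logarithms: decomposition along exact relations.** See the
module docstring. [cite: Baker1975, Theorem 2.1] -/
theorem liouville_decomposition {A : ℕ} {ζ₀ ζ₁ : Fin A → ℂ}
    (hζ₀ : ∀ k, IsAlgebraic ℚ (ζ₀ k)) (hζ₁ : ∀ k, IsAlgebraic ℚ (ζ₁ k))
    (hζ₀0 : ∀ k, ζ₀ k ≠ 0) (hζ₁0 : ∀ k, ζ₁ k ≠ 0)
    {γ δ : Fin A → ℝ} (hγ : ∀ k, IsAlgebraic ℚ (γ k)) (hδ : ∀ k, IsAlgebraic ℚ (δ k))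
    {r : ℝ} (hr : IsAlgebraic ℚ r)
    (hrel : r + ∑ k, (((γ k : ℂ) + (δ k : ℂ) * I) *
      (Complex.log (ζ₁ k) - Complex.log (ζ₀ k))).re = 0) :
    r = 0 ∧ ∃ (aR aI : (Fin A ⊕ Fin A) → ℝ) (e f : (Fin A ⊕ Fin A) → Fin A → ℚ),
      (∀ j, IsAlgebraic ℚ (aR j)) ∧ (∀ j, IsAlgebraic ℚ (aI j)) ∧
      (∀ j, ∑ k, (e j k : ℝ) * (Real.log ‖ζ₁ k‖ - Real.log ‖ζ₀ k‖) = 0) ∧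
      (∀ j, ∑ k, (f j k : ℝ) * (Complex.arg (ζ₁ k) - Complex.arg (ζ₀ k)) = 0) ∧
      ∀ Z : Fin A → ℂ, (∑ k, (((γ k : ℂ) + (δ k : ℂ) * I) * Z k).re) =
        ∑ j, (aR j * ∑ k, (e j k : ℝ) * (Z k).re - aI j * ∑ k, (f j k : ℝ) * (Z k).im) := by
  classical
  -- conjugates of algebraic numbers are algebraic (inline, via real and imaginary parts)
  have halg_conj : ∀ {z : ℂ}, IsAlgebraic ℚ z → IsAlgebraic ℚ (conj z) := by
    intro z hz
    have h := isAlgebraic_re_im hz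
    have hc : conj z = ((z.re : ℝ) : ℂ) + ((-z.im : ℝ) : ℂ) * I := by
      apply Complex.ext <;> simp
    rw [hc]
    exact isAlgebraic_ofReal_add_ofReal_mul_I h.1 h.2.neg
  set c : Fin A → ℂ := fun k => (γ k : ℂ) + (δ k : ℂ) * I with hc_def
  set c' : Fin A → ℂ := fun k => (γ k : ℂ) + ((-δ k : ℝ) : ℂ) * I with hc'_def
  have hcc' : ∀ k, c' k = conj (c k) := fun k => (conj_ofReal_add_ofReal_mul_I (γ k) (δ k)).symm
  set L : Fin A → ℂ := fun k => Complex.log (ζ₁ k) - Complex.log (ζ₀ k) with hL_def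
  set half : ℂ := (((2:ℝ)⁻¹ : ℝ) : ℂ) with hhalf
  have hhalf_alg : IsAlgebraic ℚ half := by
    have : IsAlgebraic ℚ ((2:ℝ)⁻¹) := by
      have h2 : IsAlgebraic ℚ (2:ℝ) := by simpa using isAlgebraic_algebraMap (R := ℚ) (A := ℝ) 2
      exact h2.inv
    exact this.algebraMap
  -- the family of logarithms `(L_k, conj L_k)` and coefficients `(c_k/2, c̄_k/2)`
  set ℓℓ : (Fin A ⊕ Fin A) → ℂ := Sum.elim L (fun k => conj (L k)) with hℓℓ
  set γγ : (Fin A ⊕ Fin A) → ℂ := Sum.elim (fun k => c k * half) (fun k => c' k * half) with hγγ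
  have hexpL : ∀ k, Complex.exp (L k) = ζ₁ k / ζ₀ k := fun k => by
    simp only [hL_def]
    rw [Complex.exp_sub, Complex.exp_log (hζ₁0 k), Complex.exp_log (hζ₀0 k)]
  have hℓalg : ∀ i, IsAlgebraic ℚ (Complex.exp (ℓℓ i)) := by
    rintro (k | k)
    · simp only [hℓℓ, Sum.elim_inl, hexpL]
      exact (hζ₁ k).mul (hζ₀ k).inv
    · simp only [hℓℓ, Sum.elim_inr]
      rw [Complex.exp_conj, hexpL]
      exact halg_conj ((hζ₁ k).mul (hζ₀ k).inv)
  have hγγalg : ∀ i, IsAlgebraic ℚ (γγ i) := by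
    rintro (k | k)
    · exact (isAlgebraic_ofReal_add_ofReal_mul_I (hγ k) (hδ k)).mul hhalf_alg
    · exact (isAlgebraic_ofReal_add_ofReal_mul_I (hγ k) (hδ k).neg).mul hhalf_alg
  -- the relation in complex form
  have hsumC : ∑ i, γγ i * ℓℓ i = ((∑ k, (c k * L k).re : ℝ) : ℂ) := by
    rw [Fintype.sum_sum_type, Complex.ofReal_sum, ← Finset.sum_add_distrib]
    refine Finset.sum_congr rfl fun k _ => ?_
    simp only [hγγ, hℓℓ, Sum.elim_inl, Sum.elim_inr]
    rw [ofReal_re_eq_add_conj_half, map_mul, ← hcc']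
    ring
  have hrelC : (r : ℂ) + ∑ i, γγ i * ℓℓ i = 0 := by
    rw [hsumC, ← Complex.ofReal_add]
    exact_mod_cast hrel
  -- BAKER
  obtain ⟨hr0, N, hN1, hN2⟩ := baker_decomposition_complex ℓℓ hℓalg hr.algebraMap hγγalg hrelC
  have hr0' : r = 0 := by
    rw [Complex.coe_algebraMap] at hr0
    exact_mod_cast hr0
  have h2alg : IsAlgebraic ℚ ((2:ℝ)⁻¹) := by
    have h : IsAlgebraic ℚ (2:ℝ) := by simpa using isAlgebraic_algebraMap (R := ℚ) (A := ℝ) 2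
    exact h.inv
  refine ⟨hr0', fun j => (γγ j).re, fun j => (γγ j).im,
    fun j k => N j (Sum.inl k) + N j (Sum.inr k), fun j k => N j (Sum.inl k) - N j (Sum.inr k),
    ?_, ?_, ?_, ?_, ?_⟩
  · -- `aR` algebraic
    rintro (k | k)
    · have : (γγ (Sum.inl k)).re = γ k * (2:ℝ)⁻¹ := by
        simp only [hγγ, Sum.elim_inl, hc_def, hhalf]
        rw [Complex.re_mul_ofReal]; simp
      dsimp only
      rw [this]; exact (hγ k).mul h2alg
    · have : (γγ (Sum.inr k)).re = γ k * (2:ℝ)⁻¹ := by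
        simp only [hγγ, Sum.elim_inr, hc'_def, hhalf]
        rw [Complex.re_mul_ofReal]; simp
      dsimp only
      rw [this]; exact (hγ k).mul h2alg
  · -- `aI` algebraic
    rintro (k | k)
    · have : (γγ (Sum.inl k)).im = δ k * (2:ℝ)⁻¹ := by
        simp only [hγγ, Sum.elim_inl, hc_def, hhalf]
        rw [Complex.im_mul_ofReal]; simp
      dsimp only
      rw [this]; exact (hδ k).mul h2alg
    · have : (γγ (Sum.inr k)).im = -δ k * (2:ℝ)⁻¹ := by
        simp only [hγγ, Sum.elim_inr, hc'_def, hhalf]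
        rw [Complex.im_mul_ofReal]; simp
      dsimp only
      rw [this]; exact (hδ k).neg.mul h2alg
  · -- exact relation among the `log ‖ζ₁_k‖ − log ‖ζ₀_k‖` (real part of `Σ_i N_{ji} ℓℓ_i = 0`)
    intro j
    have h := congrArg Complex.re (hN1 j)
    rw [Complex.re_sum, Fintype.sum_sum_type, Complex.zero_re] at h
    have hre : ∀ k, (L k).re = Real.log ‖ζ₁ k‖ - Real.log ‖ζ₀ k‖ := by
      intro k
      simp only [hL_def, Complex.sub_re, Complex.log_re]
    have hre' : ∀ k, (conj (L k)).re = Real.log ‖ζ₁ k‖ - Real.log ‖ζ₀ k‖ := by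
      intro k
      rw [Complex.conj_re, hre]
    have hterm : ∀ k, ((N j (Sum.inl k) : ℂ) * ℓℓ (Sum.inl k)).re +
        ((N j (Sum.inr k) : ℂ) * ℓℓ (Sum.inr k)).re =
        ((N j (Sum.inl k) + N j (Sum.inr k) : ℚ) : ℝ) * (Real.log ‖ζ₁ k‖ - Real.log ‖ζ₀ k‖) := by
      intro k
      simp only [hℓℓ, Sum.elim_inl, Sum.elim_inr, Complex.mul_re, Complex.ratCast_re,
        Complex.ratCast_im, zero_mul, sub_zero, hre, hre', Rat.cast_add]
      ring
    rw [← Finset.sum_add_distrib] at h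
    simp_rw [hterm] at h
    exact h
  · -- exact relation among the `arg ζ₁_k − arg ζ₀_k` (imaginary part)
    intro j
    have h := congrArg Complex.im (hN1 j)
    rw [Complex.im_sum, Fintype.sum_sum_type, Complex.zero_im] at h
    have him : ∀ k, (L k).im = Complex.arg (ζ₁ k) - Complex.arg (ζ₀ k) := by
      intro k
      simp only [hL_def, Complex.sub_im, Complex.log_im]
    have him' : ∀ k, (conj (L k)).im = -(Complex.arg (ζ₁ k) - Complex.arg (ζ₀ k)) := by
      intro k
      rw [Complex.conj_im, him]
    have hterm : ∀ k, ((N j (Sum.inl k) : ℂ) * ℓℓ (Sum.inl k)).im +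
        ((N j (Sum.inr k) : ℂ) * ℓℓ (Sum.inr k)).im =
        ((N j (Sum.inl k) - N j (Sum.inr k) : ℚ) : ℝ) * (Complex.arg (ζ₁ k) - Complex.arg (ζ₀ k)) := by
      intro k
      simp only [hℓℓ, Sum.elim_inl, Sum.elim_inr, Complex.mul_im, Complex.ratCast_re,
        Complex.ratCast_im, zero_mul, add_zero, him, him', Rat.cast_sub]
      ring
    rw [← Finset.sum_add_distrib] at h
    simp_rw [hterm] at h
    exact h
  · -- the universal decomposition
    intro Z
    set DD : (Fin A ⊕ Fin A) → ℂ := Sum.elim Z (fun k => conj (Z k)) with hDD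
    set E : (Fin A ⊕ Fin A) → ℂ := fun j => ∑ i, (N j i : ℂ) * DD i with hE
    -- (i) `Σ_i γγ_i DD_i = Σ_k Re(c_k Z_k)` (as complex numbers)
    have hS1 : ∑ i, γγ i * DD i = ((∑ k, (c k * Z k).re : ℝ) : ℂ) := by
      rw [Fintype.sum_sum_type, Complex.ofReal_sum, ← Finset.sum_add_distrib]
      refine Finset.sum_congr rfl fun k _ => ?_
      simp only [hγγ, hDD, Sum.elim_inl, Sum.elim_inr]
      rw [ofReal_re_eq_add_conj_half, map_mul, ← hcc']
      ring
    -- (ii) `Σ_i γγ_i DD_i = Σ_j γγ_j E_j` by the Baker decomposition of `γγ`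
    have hS2 : ∑ i, γγ i * DD i = ∑ j, γγ j * E j := by
      calc ∑ i, γγ i * DD i = ∑ i, (∑ j, γγ j * (N j i : ℂ)) * DD i :=
            Finset.sum_congr rfl fun i _ => by rw [← hN2 i]
        _ = ∑ i, ∑ j, γγ j * (N j i : ℂ) * DD i :=
            Finset.sum_congr rfl fun i _ => by rw [Finset.sum_mul]
        _ = ∑ j, ∑ i, γγ j * (N j i : ℂ) * DD i := Finset.sum_comm
        _ = ∑ j, γγ j * E j := Finset.sum_congr rfl fun j _ => by
            rw [hE, Finset.mul_sum]
            exact Finset.sum_congr rfl fun i _ => by ring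
    -- (iii) real and imaginary parts of `E_j`
    have hEre : ∀ j, (E j).re = ∑ k, ((N j (Sum.inl k) + N j (Sum.inr k) : ℚ) : ℝ) * (Z k).re := by
      intro j
      rw [hE, Complex.re_sum, Fintype.sum_sum_type, ← Finset.sum_add_distrib]
      refine Finset.sum_congr rfl fun k _ => ?_
      simp only [hDD, Sum.elim_inl, Sum.elim_inr, Complex.mul_re, Complex.ratCast_re,
        Complex.ratCast_im, zero_mul, sub_zero, Complex.conj_re, Rat.cast_add]
      ring
    have hEim : ∀ j, (E j).im = ∑ k, ((N j (Sum.inl k) - N j (Sum.inr k) : ℚ) : ℝ) * (Z k).im := by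
      intro j
      rw [hE, Complex.im_sum, Fintype.sum_sum_type, ← Finset.sum_add_distrib]
      refine Finset.sum_congr rfl fun k _ => ?_
      simp only [hDD, Sum.elim_inl, Sum.elim_inr, Complex.mul_im, Complex.ratCast_re,
        Complex.ratCast_im, zero_mul, add_zero, Complex.conj_im, Rat.cast_sub]
      ring
    -- (iv) assemble
    have key : (∑ k, (c k * Z k).re) = ∑ j, ((γγ j).re * (E j).re - (γγ j).im * (E j).im) := by
      have h := congrArg Complex.re (hS1.symm.trans hS2)
      rw [Complex.ofReal_re, Complex.re_sum] at h
      rw [h]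
      exact Finset.sum_congr rfl fun j _ => by rw [Complex.mul_re]
    rw [key]
    refine Finset.sum_congr rfl fun j _ => ?_
    rw [hEre, hEim]

end KZ.LiouvilleSector

end Literature.NumberTheory.Transcendental
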